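import Literature.Analysis.FluidPDE.PolydisperseHardSphereFlow
import Literature.Analysis.FluidPDE.HardSphereEuclideanAlexander
import HarnessLib

/-!
# Existence of the hard-sphere mixture flow (Ampatzoglou–Miller–Pavlović 2022, Thm 3.1)

One named fact (D-0014) and several PROVED instances for the hypothesis structure
`PolydisperseHardSphereFlow G m σ` of `Literature.Analysis.FluidPDE.PolydisperseHardSphereFlow`
(hard-body mixture: per-particle masses and diameters, additive contact distances, elastic
collisions with masses):

* `twoSpecies n k a b : Fin (n + k) → ℝ` — the per-particle parameter vector of a two-species
  system (`n` particles with parameter `a` followed by `k` particles with parameter `b`), with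
  `simp` lemmas; this is how AMP 2022's data `(N₁, N₂, ε₁, ε₂, M₁, M₂)` and the Einstein-bath /
  Rayleigh-gas data (spheres + ideal-gas points) are fed to the per-particle structure.
* `PolydisperseHardSphereFlow.nonempty` — **the named fact, as printed**: Ampatzoglou–Miller–
  Pavlović 2022 Thm 3.1, the global-in-time, a.e.-defined, measure-preserving flow of a binary
  mixture of hard spheres in the whole space `ℝ^d` — two species, `N₁, N₂ ≥ 1` particles,
  diameters `ε₁, ε₂ > 0`, masses `M₁, M₂ > 0`, interaction distance `(ε_α + ε_β)/2` (§2.1), mass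
  collision law (§2.2).
* PROVED: `PolydisperseHardSphereFlow.nonempty_const` (`ℝ^d`) and
  `PolydisperseHardSphereFlow.nonempty_torus_const` (`T^d`, `0 < ε < 1/2`) — the monodisperse
  instances, from the tree's Alexander THEOREMS `HardSphereFlow.nonempty_holds` /
  `HardSphereFlow.nonempty_torus_holds` through the embedding `HardSphereFlow.toPoly`; and
  `PolydisperseHardSphereFlow.nonempty_twoSpecies_self`, the equal-parameter slice of the fact,
  which is thereby a theorem.
* `contactRadius_twoSpecies` — the contact distances of the sphere–point system (sphere–sphere
  `ε`, sphere–point `ε/2`, point–point `0`: two points never interact).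

## What is printed, and what is deliberately NOT vendored here

Ampatzoglou–Miller–Pavlović 2022 Thm 3.1 (arXiv:2104.14480, §3): "Let `N₁, N₂ ∈ ℕ₊` and
`ε₁, ε₂ > 0` and recall the definition of the energy. Then there exists a family of measure
preserving maps `(Ψ^t)_{t ∈ ℝ} : 𝒟 → 𝒟` [`𝒟 ⊂ ℝ^{2d(N₁+N₂)}` the mixture phase space of §2.1] such
that (1) `Ψ^{t+s}(Z) = Ψ^t ∘ Ψ^s (Z) = Ψ^s ∘ Ψ^t (Z)` for a.e. `Z ∈ 𝒟`; (2) `E(Ψ^t Z) = E(Z)` for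
a.e. `Z ∈ 𝒟`; (3) `Ψ^t(T Z) = Ψ^t(Z)` for `ℋ^{2d(N₁+N₂)-1}`-a.e. `Z ∈ ∂_{sc,ng} 𝒟`", the maps
being the collision-by-collision dynamics of §3.2–3.3 (free flight, the collision operator `T` of
Definition 3.2 on the simple non-grazing boundary) outside a null set of data leading to
multiple, grazing or accumulating collisions — Alexander's construction redone for unequal
masses ("our case does not directly follow from [Ale75] because our mixture consists of gases of
different masses", p. 12). The bundled fields of `PolydisperseHardSphereFlow` (measurable
invariant conull good set, measurable group of polydisperse trajectories with binary non-grazing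
collisions, Lebesgue-measure preserving) are the content of that construction, exactly as the
tree's monodisperse `HardSphereFlow.nonempty` packages Alexander 1975 / GST 2013 Prop. 4.1.1.

NOT vendored as facts (no printed statement covers them; they are THEOREMS to be proved in the
tree, the monodisperse proofs `HardSphereShortTime` / `HardSphereScattering` /
`HardSphereAlexander` / `HardSphereEuclideanAlexander` being the template): the mixture flow on
the TORUS `T^d`, more than two species (AMP 2022 Remark 2.1 only remarks that the *notation*
extends to `k` types), and zero-diameter (ideal-gas point) species (the Rayleigh gas of Spohn 1991
§8.2 is an infinite system, a.s. w.r.t. the equilibrium measure — a different statement). Until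
those theorems land, torus / sphere–point consumers (Einstein bath, tagged particle) take
`(Ψ : PolydisperseHardSphereFlow (Torus.geometry d) m σ)` as an explicit hypothesis — the structure
is a hypothesis structure by design — rather than a fact asserting its existence; the proved
monodisperse instances below show the hypothesis is satisfiable.

## References

* I. Ampatzoglou, J. K. Miller, N. Pavlović, *A rigorous derivation of a Boltzmann system for a
  mixture of hard-sphere gases*, SIAM J. Math. Anal. 54 (2022), arXiv:2104.14480, §2.1–2.2, §3
  (Thm 3.1).
* R. K. Alexander, *The infinite hard sphere system*, PhD thesis, Berkeley (1975).
* C. Cercignani, R. Illner, M. Pulvirenti, *The Mathematical Theory of Dilute Gases* (1994),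
  Thm 4.2.1, App. 4.A (pp. 107–111) (identical spheres).
* H. Spohn, *Large Scale Dynamics of Interacting Particles* (1991), §8.2 (Rayleigh gas).
-/

open MeasureTheory Set

namespace Literature.Analysis.FluidPDE

noncomputable section

section Existence

variable {d : Type*} [Fintype d]

/-! ## Two-species parameter vectors -/

/-- Per-particle parameter vector of a two-species system: `n` particles of the first type with
parameter `a` (mass, or diameter) followed by `k` particles of the second type with parameter
`b` — `Fin.append (fun _ => a) (fun _ => b) : Fin (n + k) → ℝ` (AMP 2022 §2.1: `N_α` particles of
type `α` with diameter `ε_α` and mass `M_α`, types ordered `(1,0) < (0,1)`). [cite: AmpatzoglouMillerPavlovic2022, §2.1] -/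
def twoSpecies (n k : ℕ) (a b : ℝ) : Fin (n + k) → ℝ :=
  Fin.append (fun _ : Fin n => a) (fun _ : Fin k => b)

/-- On the first block `twoSpecies n k a b` is `a`. [folklore] -/
@[simp]
theorem twoSpecies_castAdd (n k : ℕ) (a b : ℝ) (i : Fin n) :
    twoSpecies n k a b (Fin.castAdd k i) = a := by
  simp [twoSpecies]

/-- On the second block `twoSpecies n k a b` is `b`. [folklore] -/
@[simp]
theorem twoSpecies_natAdd (n k : ℕ) (a b : ℝ) (j : Fin k) :
    twoSpecies n k a b (Fin.natAdd n j) = b := by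
  simp [twoSpecies]

/-- Every value of `twoSpecies n k a b` is `a` or `b`; hence a property of both values holds
everywhere. [folklore] -/
theorem twoSpecies_forall {n k : ℕ} {a b : ℝ} {p : ℝ → Prop} (ha : p a) (hb : p b) :
    ∀ i, p (twoSpecies n k a b i) := by
  intro i
  induction i using Fin.addCases with
  | left i => simpa using ha
  | right j => simpa using hb

/-- With equal parameters the two-species vector is the constant (monodisperse) one. [folklore] -/
@[simp]
theorem twoSpecies_self (n k : ℕ) (a : ℝ) : twoSpecies n k a a = fun _ => a := by
  funext i
  induction i using Fin.addCases with
  | left i => simp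
  | right j => simp

/-- The contact distances `contactRadius` of a two-species system: first–first `a`, first–second
`(a + b)/2`, second–second `b` (AMP 2022 §2.1, `ε_{(α,β)} = (ε_α + ε_β)/2`). [cite: AmpatzoglouMillerPavlovic2022, §2.1] -/
theorem contactRadius_twoSpecies' (n k : ℕ) (a b : ℝ) :
    (∀ i i' : Fin n, contactRadius (twoSpecies n k a b) (Fin.castAdd k i) (Fin.castAdd k i') = a) ∧
    (∀ (i : Fin n) (j : Fin k),
      contactRadius (twoSpecies n k a b) (Fin.castAdd k i) (Fin.natAdd n j) = (a + b) / 2) ∧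
    (∀ j j' : Fin k, contactRadius (twoSpecies n k a b) (Fin.natAdd n j) (Fin.natAdd n j') = b) := by
  refine ⟨fun i i' => ?_, fun i j => ?_, fun j j' => ?_⟩ <;> simp [contactRadius]

/-- The contact distances of the sphere–point (Einstein-bath / Rayleigh-gas) system, `n` spheres
of diameter `ε` and `k` points of diameter `0`: sphere–sphere `ε`, sphere–point `ε/2`,
point–point `0` (so two points never interact, `polyContactSet` requiring a positive contact
distance). [folklore] -/
theorem contactRadius_twoSpecies (n k : ℕ) (ε : ℝ) :
    (∀ i i' : Fin n, contactRadius (twoSpecies n k ε 0) (Fin.castAdd k i) (Fin.castAdd k i') = ε) ∧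
    (∀ (i : Fin n) (j : Fin k),
      contactRadius (twoSpecies n k ε 0) (Fin.castAdd k i) (Fin.natAdd n j) = ε / 2) ∧
    (∀ j j' : Fin k, contactRadius (twoSpecies n k ε 0) (Fin.natAdd n j) (Fin.natAdd n j') = 0) := by
  refine ⟨fun i i' => ?_, fun i j => ?_, fun j j' => ?_⟩ <;> simp [contactRadius]

/-! ## The existence statements -/

/-- **Global flow of a binary mixture of hard spheres in `ℝ^d`** (Ampatzoglou–Miller–Pavlović
2022, Thm 3.1; named fact, stated as printed). "Let `N₁, N₂ ∈ ℕ₊` and `ε₁, ε₂ > 0` … Then there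
exists a family of measure preserving maps `(Ψ^t)_{t ∈ ℝ} : 𝒟 → 𝒟` such that
`Ψ^{t+s}(Z) = Ψ^t ∘ Ψ^s (Z) = Ψ^s ∘ Ψ^t (Z)` for a.e. `Z ∈ 𝒟`, `E(Ψ^t Z) = E(Z)` for a.e. `Z ∈ 𝒟`,
and `Ψ^t(T Z) = Ψ^t(Z)` for a.e. `Z ∈ ∂_{sc,ng} 𝒟`": for `n ≥ 1` hard spheres of mass `M₁ > 0` and
diameter `ε₁ > 0` together with `k ≥ 1` hard spheres of mass `M₂ > 0` and diameter `ε₂ > 0` in the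
whole space `ℝ^d`, interacting at distance `(ε_α + ε_β)/2` (§2.1) through the elastic collision
law with masses (§2.2), the collision-by-collision dynamics (§3.2–3.3) is, outside a Lebesgue-null
set of initial data of the mixture phase space, globally defined, a measurable group of
polydisperse hard-sphere trajectories, and Lebesgue-measure preserving — i.e. the hypothesis
structure `PolydisperseHardSphereFlow (Euclidean.geometry d) (twoSpecies n k M₁ M₂)
(twoSpecies n k ε₁ ε₂)` is inhabited. The equal-parameter slice is the theorem
`PolydisperseHardSphereFlow.nonempty_twoSpecies_self`; the torus, `k`-species and zero-diameter
variants are NOT part of this fact (see the module docstring). [cite: AmpatzoglouMillerPavlovic2022, §3 Thm 3.1] -/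
def PolydisperseHardSphereFlow.nonempty : Prop :=
  ∀ (n k : ℕ), 1 ≤ n → 1 ≤ k → ∀ {M₁ M₂ ε₁ ε₂ : ℝ}, 0 < M₁ → 0 < M₂ → 0 < ε₁ → 0 < ε₂ →
    Nonempty (PolydisperseHardSphereFlow (Euclidean.geometry d) (twoSpecies n k M₁ M₂)
      (twoSpecies n k ε₁ ε₂))

/-- The monodisperse instance on the flat torus, PROVED: for `0 < ε < 1/2`, any constant mass
`μ ≠ 0` and every `N` the polydisperse structure on `T^d` with constant parameters is inhabited —
by the hard-sphere flow of the tree's Alexander theorem `HardSphereFlow.nonempty_torus_holds`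
through `HardSphereFlow.toPoly`. (The general mixture flow on `T^d` is not vendored as a fact;
torus consumers take the structure as a hypothesis, which this instance shows satisfiable.) [folklore] -/
theorem PolydisperseHardSphereFlow.nonempty_torus_const {ε : ℝ} (hε : 0 < ε) (hε' : ε < 2⁻¹)
    {μ : ℝ} (hμ : μ ≠ 0) (N : ℕ) :
    Nonempty (PolydisperseHardSphereFlow (Torus.geometry d) (fun _ : Fin N => μ) (fun _ => ε)) :=
  (HardSphereFlow.nonempty_torus_holds hε hε' N).map fun Φ => Φ.toPoly hε hμ

/-- The monodisperse instance in `ℝ^d`, PROVED: for `0 < ε`, any constant mass `μ ≠ 0` and every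
`N` the polydisperse structure on `ℝ^d` with constant parameters is inhabited — by the
hard-sphere flow of the tree's Alexander theorem `HardSphereFlow.nonempty_holds` through
`HardSphereFlow.toPoly`. [folklore] -/
theorem PolydisperseHardSphereFlow.nonempty_const {ε : ℝ} (hε : 0 < ε) {μ : ℝ} (hμ : μ ≠ 0)
    (N : ℕ) :
    Nonempty (PolydisperseHardSphereFlow (Euclidean.geometry d) (fun _ : Fin N => μ) (fun _ => ε)) :=
  (HardSphereFlow.nonempty_holds hε N).map fun Φ => Φ.toPoly hε hμ

/-- The equal-parameter slice of `PolydisperseHardSphereFlow.nonempty` is a THEOREM: two species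
with the same mass `μ ≠ 0` and the same diameter `ε > 0` in `ℝ^d` form a monodisperse gas, whose
flow is the tree's `HardSphereFlow.nonempty_holds`. [folklore] -/
theorem PolydisperseHardSphereFlow.nonempty_twoSpecies_self {ε : ℝ} (hε : 0 < ε) {μ : ℝ}
    (hμ : μ ≠ 0) (n k : ℕ) :
    Nonempty (PolydisperseHardSphereFlow (Euclidean.geometry d) (twoSpecies n k μ μ)
      (twoSpecies n k ε ε)) := by
  rw [twoSpecies_self, twoSpecies_self]
  exact PolydisperseHardSphereFlow.nonempty_const hε hμ (n + k)

/-- Likewise on the torus: two species with equal mass `μ ≠ 0` and equal diameter `0 < ε < 1/2`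
on `T^d` — inhabited by the tree's `HardSphereFlow.nonempty_torus_holds`. [folklore] -/
theorem PolydisperseHardSphereFlow.nonempty_torus_twoSpecies_self {ε : ℝ} (hε : 0 < ε)
    (hε' : ε < 2⁻¹) {μ : ℝ} (hμ : μ ≠ 0) (n k : ℕ) :
    Nonempty (PolydisperseHardSphereFlow (Torus.geometry d) (twoSpecies n k μ μ)
      (twoSpecies n k ε ε)) := by
  rw [twoSpecies_self, twoSpecies_self]
  exact PolydisperseHardSphereFlow.nonempty_torus_const hε hε' hμ (n + k)

end Existence

end

end Literature.Analysis.FluidPDE
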